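import Literature.AnabelianGeometry.EtaleTheta.Discharge.Sec2Cor218iAtModelTateNonInnerModFour
import HarnessLib

/-!
# [EtTh] Thm. 1.6 (i) / Cor. 2.18 (i) (F-0620) AT THE STAGE-2 TATE MODEL `ThetaSetting.modelχq p i 2`:
# THE INDUCED AUTOMORPHISM OF `G_{ℚ_p}` PRESERVES THE CYCLOTOMIC CHARACTER, `χ ∘ ν = χ`
# (proof-only; row «THM16I-ODDPARITY-Γ@p≡3(4)», K-L6; successor item (iii) of «THM16I-NONINNER-AT-MODELTATE»)

S. Mochizuki, *The étale theta function and its Frobenioid-theoretic manifestations* [EtTh], Publ. RIMS **45**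
(2009): Thm. 1.6 (i), PRIMS PDF p. 24 («`γ(Π^tp_{Ÿα}) = Π^tp_{Ÿβ}`») [cite: MochizukiEtTh2009, Thm 1.6 (i) p.24];
Cor. 2.18 (i), p. 60 (the named fact `RigidData.Cor218_i`, FACT-LIST F-0620) [cite: MochizukiEtTh2009, Cor 2.18(i) p.60];
§1 p. 13 (the Galois action on `(Δ^tp_X)^ell`: cyclotomic character on `Ẑ(1)·b`, Kummer cocycle of the `q`-parameter
in the corner) [cite: MochizukiEtTh2009, §1 p.13].

abc-iut cell, layer L6 / K-L6 instance column, seat abc-iut-w4-d038 (gen 11), row «THM16I-ODDPARITY-Γ@p≡3(4)»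
(abc-iut-L6-lead 2026-08-27T02:29:24Z «GO w4-d038»; successor item (iii) of abc-iut-L6-d6's memo
`HOME/staging/L6/L6-d6/g6/THM16I-NONINNER-AT-MODELTATE.md`). PROOF-ONLY: no definition, no instance, no `Prop`-valued
fact; nothing of another seat is edited or restated — inputs BY NAME (abc-iut-L6-d6 `Sec2Cor218iAtModelTateNonInner`:
`restrict_act_eq_conj`, `levelChar_four_sub_one_mul_eq`; `Sec2Cor218iAtModelTateNonInnerModFour`:
`apply_mem_GtpYdd_of_level_two_eq`, `map_deltaTempχq_symm_eq`; `Sec2Cor218iAtModelTateOfExtends`: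
`exists_restrict_of_map_deltaTemp_eq`; abc-iut-w5-d051 `SettingModelGfpRigidity`: `hHat_y_apply_eq`,
`isUnit_coeff_of_exists`, `extension_spec`, `apply_mem_ker_gfpSnd_iff`; abc-iut-L2-t6 `levelHom_actχq_x` /
`levelHom_actχq_y`; abc-iut-w5-d091 `chi`; abc-iut-w4-d056 / abc-iut-w5-d171 `ZHatLevel.levelChar`,
`ZHatLevel.ext_of_level`, `ZHatLevel.monoidHom_ext_eta`).

THE QUESTION (memo above, «Open for a successor (iii)»; abc-iut-L6-lead «GO w4-d038 THM16I-ODDPARITY-Γ@p≡3(4)»): at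
`p ≡ 3 (mod 4)`, `i` odd, does a `Δ^tp_X`-stabilising topological automorphism `Γ` of `Π^tp_X(modelχq p i 2)` with ODD
`b`-parity of `Γ(a)` (equivalently, by abc-iut-L6-d6's `map_GtpYdd_eq_iff_levelHom_two_y_eq_zero`, with
`Γ(Π^tp_Ÿ) ≠ Π^tp_Ÿ`) exist?  Writing `Γ(inl q) = inl (φ q)`, `Γ(inr σ) = inl (c σ) · inr (ν σ)`, the question is one
about the automorphism `ν` of `G_{ℚ_p}` under `Γ`.  This file supplies the MODEL-SIDE half of the negative answer:

WHAT THIS FILE PROVES (numbers, not adjectives). Throughout `D = modelχq p i 2` (ANY prime `p`, ANY `i`), `Γ` a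
topological automorphism of `Π^tp_X = Γ ⋊_{actχq} G_{ℚ_p}` restricting to `φ` on `Γ`, `ν σ := (Γ (inr σ)).right`.
§1 `levelChar_chi_right_apply_inr` — **`χ_N(ν σ) = χ_N(σ)` for every level `N`**: the relation
  `φ(σ·b) = c σ · (νσ·φ b) · (c σ)⁻¹` (`restrict_act_eq_conj` at the degree-`0` loop `b`) read in the `y`-coordinate of
  the level-`N` Heisenberg map `ĥ_N` (additive, conjugation-blind): the left side is `c₂·χ_N(σ)` (`y(ĥ_N Φ x) =
  c₁·x + c₂·y`, abc-iut-w5-d051, with `x(b) = 0`, `y(σ·b) = χ_N(σ)`), the right side is `χ_N(νσ)·c₂` (`x(φ b) = 0` since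
  `φ` preserves `Ker pr₂`), and `c₂` is a unit of `ℤ/N` (`isUnit_coeff_of_exists`).
§1 `chi_right_apply_inr_eq` / `chi_right_apply_inr_eq_of_map_deltaTemp_eq` — **`χ(ν σ) = χ(σ)` in `Aut(Ẑ) = Ẑ^×`**
  (an element of `Aut(Ẑ)` is determined by its level characters: `ZHatLevel.ext_of_level` + `monoidHom_ext_eta`);
  hypothesis-free form from `Γ(Δ^tp_X) = Δ^tp_X` via `exists_restrict_of_map_deltaTemp_eq`.
§2 `levelChar_four_chi_self_sub_one_mul_eq` — abc-iut-L6-d6's LEVEL-4 RELATION with `χ₄(νσ)` replaced by `χ₄(σ)`: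
  `(χ₄(σ) − 1)·y(ĥ₄ φ(a)) = 2·(κ₄(σ) − κ₄(ν σ))`.
§3 THE JOINT with the arithmetic half (abc-iut-w6-d051's announced `Sec2Cor218iAtModelTateOddParity.lean`: «`κ_p mod 2`
  is a function of `χ`», i.e. `χ(σ) = χ(τ) ⇒ κ₂(σ) = κ₂(τ)`, true for every prime `p` since `√p ∈ ℚ_p(ζ_{8p})`):
  `map_GtpYdd_eq_of_map_deltaTemp_eq_of_level_two_kappaP_eq_of_chi_eq` — GIVEN that implication as an explicit
  hypothesis `hκχ`, **every `Δ^tp_X`-stabilising `Γ` maps `Π^tp_Ÿ` ONTO itself, for every `i`** (so NO odd-parity `Γ`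
  exists), and `rigidData_cor218_i_modelχq_of_extends_of_level_two_kappaP_eq_of_chi_eq` — F-0620 `Cor218_i` at the
  record shape from `hextΔ` alone under `hκχ` (abc-iut-L6-d6's §4 with the `χ₄ ≡ 1` side condition replaced by `hκχ`).
  `hκχ` is a HYPOTHESIS BINDER to be discharged by the arithmetic file, not a named fact; nothing here is asserted
  about it.

HONEST LABEL: `modelχq` is a SEMI-SYNTHETIC model of the typed [EtTh] §1 interface (statement/model-pair evidence);
F-0620 stays a FACT-policy row; nothing of [EtTh] (refereed) is asserted beyond the tree's proofs; no side is taken on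
[IUTchIII] Cor. 3.12; typed ≠ proved; nothing here says abc is proved or refuted.
-/

noncomputable section

namespace Literature.AnabelianGeometry.EtaleTheta

namespace SettingModel

open Literature.AnabelianGeometry.SemiGraphs Function Topology

variable (p : ℕ) [Fact p.Prime] (i : ℤ)

/-! ## §0. The degree-`0` loop `b` -/

/-- The level-`N` Heisenberg coordinates of the loop `b = gfpOf (of 1)`: `(x, y, z) = (0, 1, 0)`.
[cite: MochizukiEtTh2009, §1 p.12] -/
theorem levelHom_gfpOf_one (N : ℕ+) : levelHom N (gfpOf (FreeGroup.of 1)) = ⟨0, 1, 0⟩ := by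
  rw [levelHom_gfpOf, heisHom_of_one, Heis.map_apply]
  ext <;> simp

/-- The loop `b` has degree `0`: `b ∈ Ker pr₂ = Δ^tp_Y`. [cite: MochizukiEtTh2009, §1 p.12] -/
theorem gfpOf_one_mem_ker_gfpSnd : gfpOf (FreeGroup.of 1) ∈ gfpSnd.ker := by
  rw [MonoidHom.mem_ker, gfpSnd_gfpOf, expA_of_one]

/-! ## §1. `χ ∘ ν = χ` -/

/-- **`χ_N(ν σ) = χ_N(σ)` for every level `N`.** Let `Γ` be a topological automorphism of `Π^tp_X(modelχq p i 2)`
restricting to `φ` on `Γ`, and write `Γ(inr σ) = inl (c σ) · inr (ν σ)`. Reading `φ(σ·b) = c σ · (νσ·φ(b)) · (c σ)⁻¹`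
in the (additive, conjugation-invariant) `y`-coordinate of `ĥ_N` gives `c₂·χ_N(σ) = χ_N(νσ)·c₂` with `c₂ = y(ĥ_N Φ(b))`
a unit of `ℤ/N`. [cite: MochizukiEtTh2009, §1 p.13] -/
theorem levelChar_chi_right_apply_inr (Γ : PiTpχq p i 2 ≃ₜ* PiTpχq p i 2) (φ : Gfp ≃ₜ* Gfp)
    (hφ : ∀ q : Gfp, Γ (SemidirectProduct.inl q) = SemidirectProduct.inl (φ q)) (σ : GQp p) (N : ℕ+) :
    ZHatLevel.levelChar N (chi p (Γ (SemidirectProduct.inr σ)).right) = ZHatLevel.levelChar N (chi p σ) := by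
  set c : Gfp := (Γ (SemidirectProduct.inr σ)).left with hc
  set τ : GQp p := (Γ (SemidirectProduct.inr σ)).right with hτ
  set qb : Gfp := gfpOf (FreeGroup.of 1) with hqb
  -- the relation `φ (σ·qb) = c · τ·(φ qb) · c⁻¹` in `Γ`
  have hE : φ (actχq p i 2 σ qb) = c * actχq p i 2 τ (φ qb) * c⁻¹ := restrict_act_eq_conj p i Γ φ hφ σ qb
  -- extend `φ` along the profinite completion `pr₁ : Γ → F̂₂`
  obtain ⟨Φ, hΦ⟩ := isProfiniteCompletion_gfpFst.exists_extension
    (⟨gfpFst.toMonoidHom.comp φ.toMulEquiv.toMonoidHom, gfpFst.continuous.comp φ.continuous⟩ : Gfp →ₜ* F₂hatT)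
  have hΦ' : ∀ q : Gfp, Φ (gfpFst q) = gfpFst (φ q) := fun q => hΦ q
  obtain ⟨-, hb⟩ := extension_spec φ hΦ'
  -- `levelHom N ∘ φ = ĥ_N ∘ Φ ∘ pr₁`
  have hlev : ∀ q : Gfp, levelHom N (φ q) = hHat N (Φ (gfpFst q)) := fun q => by
    change hHat N (gfpFst (φ q)) = _; rw [hΦ']
  -- the coefficient `c₂ = y(ĥ_N Φ(b))`, a unit
  set c₂ : ZMod ((N : ℕ+) : ℕ) := (hHat N (Φ (eta (FreeGroup.of 1)))).y with hc₂
  have hc₂u : IsUnit c₂ := isUnit_coeff_of_exists Φ N hb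
  have hqb1 : gfpFst qb = eta (FreeGroup.of 1) := rfl
  have hqbx : (levelHom N qb).x = 0 := by rw [hqb, levelHom_gfpOf_one]
  have hqby : (levelHom N qb).y = 1 := by rw [hqb, levelHom_gfpOf_one]
  -- `y(φ qb) = c₂`, `x(φ qb) = 0`
  have hφy : (levelHom N (φ qb)).y = c₂ := by rw [hlev, hqb1]
  have hφx : (levelHom N (φ qb)).x = 0 :=
    levelHom_x_eq_zero ((apply_mem_ker_gfpSnd_iff φ qb).mpr gfpOf_one_mem_ker_gfpSnd)
  -- LHS `y`
  have hLy : (levelHom N (φ (actχq p i 2 σ qb))).y = c₂ * ZHatLevel.levelChar N (chi p σ) := by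
    rw [hlev, hHat_y_apply_eq Φ N, ← hc₂]
    change _ * (levelHom N (actχq p i 2 σ qb)).x + c₂ * (levelHom N (actχq p i 2 σ qb)).y = _
    rw [levelHom_actχq_x, levelHom_actχq_y, hqbx, hqby]
    ring
  -- RHS `y`
  have hRy : (levelHom N (c * actχq p i 2 τ (φ qb) * c⁻¹)).y = c₂ * ZHatLevel.levelChar N (chi p τ) := by
    rw [map_mul, map_mul, map_inv, Heis.mul_y, Heis.mul_y, Heis.inv_y, levelHom_actχq_y, hφy, hφx]
    ring
  have key : c₂ * ZHatLevel.levelChar N (chi p σ) = c₂ * ZHatLevel.levelChar N (chi p τ) := by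
    rw [← hLy, ← hRy, hE]
  exact (hc₂u.mul_left_cancel key).symm

/-- **`χ(ν σ) = χ(σ)` in `Aut(Ẑ) = Ẑ^×`**: the automorphism of `G_{ℚ_p}` induced by a topological automorphism of
`Π^tp_X(modelχq p i 2)` restricting to `Γ` preserves the cyclotomic character (an element of `Aut(Ẑ)` is determined by
its level characters). [cite: MochizukiEtTh2009, §1 p.13] -/
theorem chi_right_apply_inr_eq (Γ : PiTpχq p i 2 ≃ₜ* PiTpχq p i 2) (φ : Gfp ≃ₜ* Gfp)
    (hφ : ∀ q : Gfp, Γ (SemidirectProduct.inl q) = SemidirectProduct.inl (φ q)) (σ : GQp p) :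
    chi p (Γ (SemidirectProduct.inr σ)).right = chi p σ := by
  have h1 : (chi p (Γ (SemidirectProduct.inr σ)).right) (ZHatLevel.eta 1) = (chi p σ) (ZHatLevel.eta 1) :=
    ZHatLevel.ext_of_level fun n => by
      have h := levelChar_chi_right_apply_inr p i Γ φ hφ σ n
      rw [ZHatLevel.levelChar_apply, ZHatLevel.levelChar_apply] at h
      exact Multiplicative.toAdd.injective h
  have h2 := ZHatLevel.monoidHom_ext_eta (φ := (chi p (Γ (SemidirectProduct.inr σ)).right).toMonoidHom)
    (ψ := (chi p σ).toMonoidHom) h1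
  exact MulEquiv.ext fun x => DFunLike.congr_fun h2 x

/-- **`χ ∘ ν = χ` for every `Δ^tp_X`-stabilising topological automorphism `Γ` of `Π^tp_X(modelχq p i 2)`**, with
`ν σ := (Γ (inr σ)).right` (hypothesis-free form: `Γ` restricts to some `φ` on `Γ` by
`exists_restrict_of_map_deltaTemp_eq`). [cite: MochizukiEtTh2009, §1 p.13] -/
theorem chi_right_apply_inr_eq_of_map_deltaTemp_eq (Γ : PiTpχq p i 2 ≃ₜ* PiTpχq p i 2)
    (hΔ : (curveχq p i 2).DeltaTemp.map Γ.toMulEquiv.toMonoidHom = (curveχq p i 2).DeltaTemp) (σ : GQp p) :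
    chi p (Γ (SemidirectProduct.inr σ)).right = chi p σ := by
  obtain ⟨φ, hφ⟩ := exists_restrict_of_map_deltaTemp_eq p i Γ hΔ
  exact chi_right_apply_inr_eq p i Γ φ hφ σ

/-- Level-`N` hypothesis-free form: `χ_N(ν σ) = χ_N(σ)`. [cite: MochizukiEtTh2009, §1 p.13] -/
theorem levelChar_chi_right_apply_inr_of_map_deltaTemp_eq (Γ : PiTpχq p i 2 ≃ₜ* PiTpχq p i 2)
    (hΔ : (curveχq p i 2).DeltaTemp.map Γ.toMulEquiv.toMonoidHom = (curveχq p i 2).DeltaTemp) (σ : GQp p)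
    (N : ℕ+) :
    ZHatLevel.levelChar N (chi p (Γ (SemidirectProduct.inr σ)).right) = ZHatLevel.levelChar N (chi p σ) := by
  rw [chi_right_apply_inr_eq_of_map_deltaTemp_eq p i Γ hΔ σ]

/-! ## §2. The level-4 relation with `χ₄(σ)` -/

/-- **`(χ₄(σ) − 1) · y(ĥ₄ φ(a)) = 2 · (κ₄(σ) − κ₄(ν σ))` in `ℤ/4`**: abc-iut-L6-d6's level-`4` abelianised relation
`levelChar_four_sub_one_mul_eq` with `χ₄(ν σ) = χ₄(σ)` (§1). [cite: MochizukiEtTh2009, §1 p.13] -/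
theorem levelChar_four_chi_self_sub_one_mul_eq (Γ : PiTpχq p i 2 ≃ₜ* PiTpχq p i 2) (φ : Gfp ≃ₜ* Gfp)
    (hφ : ∀ q : Gfp, Γ (SemidirectProduct.inl q) = SemidirectProduct.inl (φ q)) (σ : GQp p) :
    (ZHatLevel.levelChar 4 (chi p σ) - 1) * (levelHom 4 (φ (gfpOf (FreeGroup.of 0)))).y =
      2 * (Multiplicative.toAdd (ZHatLevel.level 4 (kappaP p σ)) -
        Multiplicative.toAdd (ZHatLevel.level 4 (kappaP p (Γ (SemidirectProduct.inr σ)).right))) := by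
  rw [← levelChar_chi_right_apply_inr p i Γ φ hφ σ 4]
  exact levelChar_four_sub_one_mul_eq p i Γ φ hφ σ

/-! ## §3. The joint with the arithmetic half: no odd-parity `Γ` once `κ_p mod 2` is a function of `χ` -/

/-- **Thm. 1.6 (i) at `modelχq p i 2` for EVERY `Δ^tp_X`-stabilising topological automorphism `Γ` and EVERY `i`, GIVEN
that `κ_p mod 2` is a function of `χ` on `G_{ℚ_p}`** (`hκχ : χ(σ) = χ(τ) ⇒ κ₂(σ) = κ₂(τ)`; the arithmetic half, true
for every prime since `√p ∈ ℚ_p(ζ_{8p})`, supplied by a separate file): by §1 `χ(νσ) = χ(σ)`, so `κ₂(νσ) = κ₂(σ)`,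
so the level-`2` equality of abc-iut-L6-d6's `apply_mem_GtpYdd_of_level_two_eq` holds for `Γ` and `Γ⁻¹`.  Consequently
NO `Δ^tp_X`-stabilising `Γ` with `Γ(Π^tp_Ÿ) ≠ Π^tp_Ÿ` (odd `b`-parity of `Γ(a)`) exists.
[cite: MochizukiEtTh2009, Thm 1.6 (i) p.24] -/
theorem map_GtpYdd_eq_of_map_deltaTemp_eq_of_level_two_kappaP_eq_of_chi_eq
    (hκχ : ∀ σ τ : GQp p, chi p σ = chi p τ →
      ZHatLevel.level 2 (kappaP p σ) = ZHatLevel.level 2 (kappaP p τ))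
    (Γ : PiTpχq p i 2 ≃ₜ* PiTpχq p i 2)
    (hΔ : (curveχq p i 2).DeltaTemp.map Γ.toMulEquiv.toMonoidHom = (curveχq p i 2).DeltaTemp) :
    (ThetaSetting.modelχq p i 2 even_two).GtpYdd.map Γ.toMulEquiv.toMonoidHom =
      (ThetaSetting.modelχq p i 2 even_two).GtpYdd := by
  have hlev : ∀ (Γ' : PiTpχq p i 2 ≃ₜ* PiTpχq p i 2),
      (curveχq p i 2).DeltaTemp.map Γ'.toMulEquiv.toMonoidHom = (curveχq p i 2).DeltaTemp →
      ∀ σ : GQp p, ZHatLevel.level 2 (kappaP p σ ^ i) =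
        ZHatLevel.level 2 (kappaP p (Γ' (SemidirectProduct.inr σ)).right ^ i) := fun Γ' hΔ' σ => by
    rw [map_zpow, map_zpow, hκχ σ _ (chi_right_apply_inr_eq_of_map_deltaTemp_eq p i Γ' hΔ' σ).symm]
  refine le_antisymm ?_ ?_
  · rintro _ ⟨g, hg, rfl⟩
    exact apply_mem_GtpYdd_of_level_two_eq p i Γ hΔ (hlev Γ hΔ) hg
  · intro g hg
    exact ⟨Γ.symm g, apply_mem_GtpYdd_of_level_two_eq p i Γ.symm (map_deltaTempχq_symm_eq p i Γ hΔ)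
      (hlev Γ.symm (map_deltaTempχq_symm_eq p i Γ hΔ)) hg, Γ.apply_symm_apply g⟩

/-- The same with the arithmetic hypothesis at the binder shape «`χ ∘ ν = χ ⇒ κ₂ ∘ ν = κ₂`» for maps `ν : G_{ℚ_p} → G_{ℚ_p}`
(the form in which the question was posed: automorphisms `ν` of `G_{ℚ_p}` preserving `χ` preserve `κ_p mod 2`).
[cite: MochizukiEtTh2009, Thm 1.6 (i) p.24] -/
theorem map_GtpYdd_eq_of_map_deltaTemp_eq_of_level_two_kappaP_comp_eq
    (hκν : ∀ ν : GQp p → GQp p, (∀ σ, chi p (ν σ) = chi p σ) →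
      ∀ σ, ZHatLevel.level 2 (kappaP p (ν σ)) = ZHatLevel.level 2 (kappaP p σ))
    (Γ : PiTpχq p i 2 ≃ₜ* PiTpχq p i 2)
    (hΔ : (curveχq p i 2).DeltaTemp.map Γ.toMulEquiv.toMonoidHom = (curveχq p i 2).DeltaTemp) :
    (ThetaSetting.modelχq p i 2 even_two).GtpYdd.map Γ.toMulEquiv.toMonoidHom =
      (ThetaSetting.modelχq p i 2 even_two).GtpYdd := by
  have hlev : ∀ (Γ' : PiTpχq p i 2 ≃ₜ* PiTpχq p i 2),
      (curveχq p i 2).DeltaTemp.map Γ'.toMulEquiv.toMonoidHom = (curveχq p i 2).DeltaTemp →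
      ∀ σ : GQp p, ZHatLevel.level 2 (kappaP p σ ^ i) =
        ZHatLevel.level 2 (kappaP p (Γ' (SemidirectProduct.inr σ)).right ^ i) := fun Γ' hΔ' σ => by
    rw [map_zpow, map_zpow, hκν (fun σ => (Γ' (SemidirectProduct.inr σ)).right)
      (chi_right_apply_inr_eq_of_map_deltaTemp_eq p i Γ' hΔ') σ]
  refine le_antisymm ?_ ?_
  · rintro _ ⟨g, hg, rfl⟩
    exact apply_mem_GtpYdd_of_level_two_eq p i Γ hΔ (hlev Γ hΔ) hg
  · intro g hg
    exact ⟨Γ.symm g, apply_mem_GtpYdd_of_level_two_eq p i Γ.symm (map_deltaTempχq_symm_eq p i Γ hΔ)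
      (hlev Γ.symm (map_deltaTempχq_symm_eq p i Γ hΔ)) hg, Γ.apply_symm_apply g⟩

/-- **In particular the `b`-parity of `Γ(a)` is EVEN** (`y(ĥ₂((Γ(inl a)).left)) = 0`) for every `Δ^tp_X`-stabilising `Γ`
at odd `i`, `p ≢ 1 (mod 4)`, under `hκχ` — abc-iut-L6-d6's criterion `map_GtpYdd_eq_iff_levelHom_two_y_eq_zero` read
backwards: the odd-parity `Γ` asked for by the row does not exist. [cite: MochizukiEtTh2009, Thm 1.6 (i) p.24] -/
theorem levelHom_two_y_eq_zero_of_level_two_kappaP_eq_of_chi_eq (hi : Odd i) (hp : p % 4 ≠ 1)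
    (hκχ : ∀ σ τ : GQp p, chi p σ = chi p τ →
      ZHatLevel.level 2 (kappaP p σ) = ZHatLevel.level 2 (kappaP p τ))
    (Γ : PiTpχq p i 2 ≃ₜ* PiTpχq p i 2)
    (hΔ : (curveχq p i 2).DeltaTemp.map Γ.toMulEquiv.toMonoidHom = (curveχq p i 2).DeltaTemp) :
    (levelHom 2 (Γ (SemidirectProduct.inl (gfpOf (FreeGroup.of 0)))).left).y = 0 :=
  (map_GtpYdd_eq_iff_levelHom_two_y_eq_zero p i hi hp Γ hΔ).mp
    (map_GtpYdd_eq_of_map_deltaTemp_eq_of_level_two_kappaP_eq_of_chi_eq p i hκχ Γ hΔ)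

/-- **F-0620 `Cor218_i` at `modelχq p i 2`, for every étale-theta datum `E`, every `X̲̲`-choice `C`, every level `μ`,
`hC`, `hS`, `h15` and the EMPTY cusp labelling, FROM `hextΔ` alone, GIVEN `hκχ`** (abc-iut-L6-d6's
`rigidData_cor218_i_modelχq_of_extends_of_levelChar_four` with the side condition `χ₄ ≡ 1` replaced by the arithmetic
hypothesis; for `p ≡ 1 (mod 4)` and for even `i` abc-iut-L6-d6's files need neither). CONDITIONAL-AT-MODEL:
F-0620@instance is NOT decided. [cite: MochizukiEtTh2009, Cor 2.18(i) p.60] -/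
theorem rigidData_cor218_i_modelχq_of_extends_of_level_two_kappaP_eq_of_chi_eq
    (hκχ : ∀ σ τ : GQp p, chi p σ = chi p τ →
      ZHatLevel.level 2 (kappaP p σ) = ZHatLevel.level 2 (kappaP p τ))
    {E : (ThetaSetting.modelχq p i 2 even_two).EtaleThetaData} {l : ℕ} (C : E.DoubleUnderline l) {N : ℕ+}
    (μ : (ThetaSetting.modelχq p i 2 even_two).CyclotomeMod l N) (hC : (ThetaSetting.modelχq p i 2 even_two).Compat)
    (hS : (ThetaSetting.modelχq p i 2 even_two).Sec2Hyps) (h15 : ThetaSetting.Prop15iii E hC)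
    (hext : ∀ γ : ↥C.Huu ≃ₜ* ↥C.Huu, ∃ Γ : PiTpχq p i 2 ≃ₜ* PiTpχq p i 2,
      (∀ h : C.Huu, Γ (h : PiTpχq p i 2) = ((γ h : C.Huu) : PiTpχq p i 2)) ∧
        (curveχq p i 2).DeltaTemp.map Γ.toMulEquiv.toMonoidHom = (curveχq p i 2).DeltaTemp) :
    (C.rigidData μ hC hS h15 ⟨fun _ => ∅, fun _ => ∅, fun _ => rfl⟩).Cor218_i := by
  refine C.rigidData_cor218_i_of_extends μ hC hS h15 _ (fun γ => ?_) (fun γ a => Set.image_empty _)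
  obtain ⟨Γ, hΓ, hΔ⟩ := hext γ
  exact ⟨Γ, hΓ, hΔ, map_GtpYdd_eq_of_map_deltaTemp_eq_of_level_two_kappaP_eq_of_chi_eq p i hκχ Γ hΔ⟩

end SettingModel

end Literature.AnabelianGeometry.EtaleTheta

end
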